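/-
Copyright (c) 2026 the pub-hodgecm-mathlib formalisation cell (harness21).  Prover seat hodgecm-mathlib-F0P3a-p05 (g18): road «S3-ram» (LEAD F0P3a-plan (g13);
owner ∕ (α) keeper F0P3a-p06 (g16); (Cnt2′) chair F0P3a-p07 (g15) RULING (16)(b) «REGIME A-EVEN HYPERBOLIC», W-side): the CENTRED kind counts of the TOP root region,
the `_of_top` twins of F0P3a-p08 (g21)'s ★∕filed (K5-B-J) FILE 1; 2026-09-02.
-/
import Literature.NumberTheory.Automorphic.UnitaryLatticeTreeBlockRootRegionAxisKinds   -- ★∕filed p849463 (F0P3a-p08 (g21)) (K5-B-J) FILE 1: §1 centred-token dictionary `forall_centred_mulVec_mem_scaleLattice_latt_endoGL_one_iff`, `exists_centred_class_latt_endoGL_one_iff`; brings ★ p849125, ★ (z1-d)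
import Literature.NumberTheory.Automorphic.UnitaryLatticeTreeBlockRootRegionAxisTop     -- ★ p849253 (F0P3a-p01 (g18)): THM 2 `single_one_one_mem_of_mem_rootRegion_of_top` (A-even: the isotropic-kernel argument)
import HarnessLib

/-!
# The lattice graph of a hermitian space — the root region of the block literal `ι(B₀, 1)` AT THE TOP LEVEL (regime A-even), KEYED BY THE CENTRED KIND TOKENS with a
# free class constant, counted on the `W`-side (Bruhat–Tits 1972 §10; Kottwitz 1986 §3; Rogawski 1990 §4.9)

Topic `NumberTheory/Automorphic`; namespace `Literature.NumberTheory.Automorphic.UnitaryLatticeTree`.  THEOREMS ONLY (no definition, no instance, no notation, no named fact,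
no `sorry`); kernel lane `--supports stmt-HodgeConjecture-24833`; datum-free.  Cell `pub/hodgecm-mathlib` (D-0151), crux H413; road «S3-ram» (count-neutral); (Cnt2′) route B.
F0P3a-p08 (g21)'s (K5-B-J) FILE 1 (`UnitaryLatticeTreeBlockRootRegionAxisKinds`) transports the KIND-KEYED root region of `γ = ι(B₀, 1)` — kinds `Pin v` (the centred `W`-part
of `v` is deeper than `d₀`) and `Qbig v` (the centred rank-one class of the `W`-part at scale `d₀` against `t₀ = (ϖ^{d₀})⁻¹(½tr B₀ − 1)`) — to the `W`-side under the REGIME-B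
premise `|det(B₀ − 1)| > |ϖ|^{2d₀+1}`.  In regime **A-even** (`N = 2n`, `d₀ = N − 1`, `|½tr B₀ − 1| ≤ |ϖ|^{d₀+1}`) that premise fails, `t₀` is not a unit, and the region is
tube-free by F0P3a-p01 (g18)'s ★ isotropic-kernel theorem `single_one_one_mem_of_mem_rootRegion_of_top` instead (premises `|2| = 1`, `B₀ ∈ U(σ, Φ₂)`, `hα`, and TOP-ness
`htop` = the centred `ϖ^{d₀+1}`-ball of `B₀`-fixed self-dual `W`-lattices is empty — dischargeable at the CM place by this seat's ★ part X).  THIS FILE gives the three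
`_of_top` twins with a FREE class constant `t` (token texts = p08's VERBATIM with `t` for `t₀`; same ★ §1 dictionary, same ★ (z1-d) `ncard_selfDual_fixed_axis_eq`):
* **`ncard_rootRegion_inner_eq_ncard_two_of_top`** — `#{v ∣ v ∈ R ∧ Pin v} = #{B ∣ SD B ∧ B₀B = B ∧ ((B₀ − 1)B ≤ ϖ^{d₀}B ∧ (B₀ − cB·1)B ≤ ϖ^{d₀+1}B)}` (`= 0` in A-even);
* **`ncard_rootRegion_shell_class_eq_ncard_two_of_top`** ∕ **`ncard_rootRegion_shell_not_class_eq_ncard_two_of_top`** — `#{v ∈ R ∧ ¬Pin v ∧ [¬]Qbig_t v}` =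
  `#{B ∣ … ∧ ((B₀ − 1)B ≤ ϖ^{d₀}B ∧ ¬(B₀ − cB·1)B ≤ ϖ^{d₀+1}B ∧ [¬]CLS^{c,W}_{d₀}(t)(B))}` — evaluated at the CM place by this seat's ★ part X centred top-shell halves
  (`2·# = q + 1` for every unit `t`).
HONEST LABEL: HC_CM is proved only modulo the 2 remaining named inputs (hLiu418 24832, h413 24833) until rung 0 closes; nothing printed is asserted here (elementary lattice
bookkeeping over ★ results); «S3-ram» has no books consequence.

## References
* [BruhatTits1972] F. Bruhat, J. Tits, *Groupes réductifs sur un corps local I*, Publ. Math. IHÉS 41 (1972), §10 (lattice models; the axis of a Levi block).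
* [Kottwitz1986] R. E. Kottwitz, *Base change for unit elements of Hecke algebras*, Compositio Math. 60 (1986), §3 (fixed lattices of a block element along the axis).
* [LabesseLanglands1979] J.-P. Labesse, R. P. Langlands, *L-indistinguishability for SL(2)*, Canad. J. Math. 31 (1979), §2 Lemma 2.1 p. 8.
* [Rogawski1990] J. D. Rogawski, *Automorphic Representations of Unitary Groups in Three Variables*, Ann. of Math. Stud. 123 (1990), §4.8 Case (a) p. 53, §4.9 pp. 54–56.
-/

set_option autoImplicit false

noncomputable section

open scoped Valued WithZero Matrix MatrixGroups

namespace Literature.NumberTheory.Automorphic.UnitaryLatticeTree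

open Literature.NumberTheory.Automorphic Literature.NumberTheory.Automorphic.HermitianLattice Literature.NumberTheory.Rogawski1990

variable {K : Type*} [Field K] [Valued K ℤᵐ⁰]

/-! ## The three kinds of the top root region, counted on the `W`-side -/

set_option maxHeartbeats 1600000 in -- budget only: statement-heavy lattice tokens.
/-- **THE INNER KIND OF THE ROOT REGION AT THE TOP LEVEL, COUNTED ON THE `W`-SIDE** (regime A-even: `|½tr B₀ − 1| ≤ |ϖ^(d₀+1)|`, top `W`-ball empty — F0P3a-p01 (g18) ★ p849253
`single_one_one_mem_of_mem_rootRegion_of_top` in place of the determinant criterion of F0P3a-p08 (g21)'s regime-B head `ncard_rootRegion_inner_eq_ncard_two`; cf. regime B of the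
hyperbolic literal: `d₀ = m`, ★ A-p19 `v_det_rerootedCentred_sub_one_eq_ram`), `cB = ½tr B₀`:
`#{v ∣ v ∈ R ∧ Pin v} = #{B ∣ SD_{Φ₂} B ∧ B₀B = B ∧ ((B₀ − 1)B ≤ ϖ^{d₀}B ∧ (B₀ − cB·1)B ≤ ϖ^{d₀+1}B)}` (the centred `W`-ball one step inside the region).
[cite: Kottwitz1986, §3] [cite: BruhatTits1972, §10] [cite: Rogawski1990, §4.9 pp. 54–56] -/
theorem ncard_rootRegion_inner_eq_ncard_two_of_top [IsPrincipalIdealRing 𝒪[K]] {σ : K →+* K} {ϖ : K}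
    (hσ : ∀ a, σ (σ a) = a) (hvσ : ∀ a, Valued.v (σ a) = Valued.v a) (hϖ : Valued.v ϖ = WithZero.exp (-1 : ℤ))
    (γ : unitaryGroupOfForm σ ((StdForm.antidiagonal 3).over K)) (B₀ : GL (Fin 2) K) (hγ : (γ : GL (Fin 3) K) = endoGL (B₀, (1 : GL (Fin 1) K))) {d₀ : ℕ}
    (h2 : Valued.v (2 : K) = 1) (hγU : B₀ ∈ unitaryGroupOfForm σ (!![(0 : K), 1; 1, 0] : Matrix (Fin 2) (Fin 2) K))
    (hα : Valued.v ((B₀ : Matrix (Fin 2) (Fin 2) K).trace / 2 - 1) ≤ Valued.v (ϖ ^ (d₀ + 1)))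
    (htop : {B : Submodule 𝒪[K] (Fin 2 → K) | IsSelfDualLattice σ ϖ (!![(0 : K), 1; 1, 0] : Matrix (Fin 2) (Fin 2) K) B ∧ mapGL B₀ B = B ∧
        B.map ((Matrix.toLin' ((B₀ : Matrix (Fin 2) (Fin 2) K) - ((B₀ : Matrix (Fin 2) (Fin 2) K).trace / 2) • (1 : Matrix (Fin 2) (Fin 2) K))).restrictScalars 𝒪[K]) ≤
          scaleLattice (ϖ ^ (d₀ + 1)) B} = ∅) :
    {v : {M : Submodule 𝒪[K] (Fin 3 → K) // IsVertex σ ϖ ((StdForm.antidiagonal 3).over K) M} | v ∈ {v : {M : Submodule 𝒪[K] (Fin 3 → K) // IsVertex σ ϖ ((StdForm.antidiagonal 3).over K) M} | latticeGraphIso σ ϖ ((StdForm.antidiagonal 3).over K) γ v = v ∧ IsSelfDualLattice σ ϖ ((StdForm.antidiagonal 3).over K) v.1 ∧ v.1.map ((Matrix.toLin' (((γ : GL (Fin 3) K) : Matrix (Fin 3) (Fin 3) K) - 1)).restrictScalars 𝒪[K]) ≤ scaleLattice (ϖ ^ d₀) v.1} ∧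
        ∀ y ∈ v.1, y 1 = 0 → ((((γ : GL (Fin 3) K) : Matrix (Fin 3) (Fin 3) K) - ((B₀ : Matrix (Fin 2) (Fin 2) K).trace / 2) • (1 : Matrix (Fin 3) (Fin 3) K)) *ᵥ y) ∈ scaleLattice (ϖ ^ (d₀ + 1)) v.1}.ncard =
    {B : Submodule 𝒪[K] (Fin 2 → K) | IsSelfDualLattice σ ϖ (!![(0 : K), 1; 1, 0] : Matrix (Fin 2) (Fin 2) K) B ∧ mapGL B₀ B = B ∧
        (B.map ((Matrix.toLin' ((B₀ : Matrix (Fin 2) (Fin 2) K) - 1)).restrictScalars 𝒪[K]) ≤ scaleLattice (ϖ ^ d₀) B ∧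
          B.map ((Matrix.toLin' ((B₀ : Matrix (Fin 2) (Fin 2) K) - ((B₀ : Matrix (Fin 2) (Fin 2) K).trace / 2) • (1 : Matrix (Fin 2) (Fin 2) K))).restrictScalars 𝒪[K]) ≤
            scaleLattice (ϖ ^ (d₀ + 1)) B)}.ncard := by
  have hϖ0' : Valued.v ϖ ≠ 0 := by rw [hϖ]; exact WithZero.exp_ne_zero
  have hϖ0 : ϖ ≠ 0 := fun h0 => by rw [h0, map_zero] at hϖ0'; exact hϖ0' rfl
  have hϖ1 : Valued.v ϖ ≤ 1 := by rw [hϖ, ← WithZero.exp_zero]; exact WithZero.exp_le_exp.2 (by norm_num)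
  have hH₂ : IsUnit (!![(0 : K), 1; 1, 0] : Matrix (Fin 2) (Fin 2) K).det := by
    rw [Matrix.det_fin_two]; simp
  have hu : Valued.v (((1 : GL (Fin 1) K) : Matrix (Fin 1) (Fin 1) K) 0 0) = 1 := by rw [Units.val_one, Matrix.one_apply_eq, map_one]
  have hud : Valued.v (((1 : GL (Fin 1) K) : Matrix (Fin 1) (Fin 1) K) 0 0 - 1) ≤ Valued.v (ϖ ^ d₀) := by
    rw [Units.val_one, Matrix.one_apply_eq, sub_self, map_zero]; exact zero_le
  have hα' : Valued.v ((B₀ : Matrix (Fin 2) (Fin 2) K).trace / 2 - ((1 : GL (Fin 1) K) : Matrix (Fin 1) (Fin 1) K) 0 0) ≤ Valued.v (ϖ ^ (d₀ + 1)) := by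
    rw [Units.val_one, Matrix.one_apply_eq]; exact hα
  -- the vertex set is the copy of the rank-3 lattice set under `v ↦ v.1`, and every member is an axis vertex (★ p849253 THM 2)
  have himg : (Subtype.val '' {v : {M : Submodule 𝒪[K] (Fin 3 → K) // IsVertex σ ϖ ((StdForm.antidiagonal 3).over K) M} | v ∈ {v : {M : Submodule 𝒪[K] (Fin 3 → K) // IsVertex σ ϖ ((StdForm.antidiagonal 3).over K) M} | latticeGraphIso σ ϖ ((StdForm.antidiagonal 3).over K) γ v = v ∧ IsSelfDualLattice σ ϖ ((StdForm.antidiagonal 3).over K) v.1 ∧ v.1.map ((Matrix.toLin' (((γ : GL (Fin 3) K) : Matrix (Fin 3) (Fin 3) K) - 1)).restrictScalars 𝒪[K]) ≤ scaleLattice (ϖ ^ d₀) v.1} ∧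
        ∀ y ∈ v.1, y 1 = 0 → ((((γ : GL (Fin 3) K) : Matrix (Fin 3) (Fin 3) K) - ((B₀ : Matrix (Fin 2) (Fin 2) K).trace / 2) • (1 : Matrix (Fin 3) (Fin 3) K)) *ᵥ y) ∈ scaleLattice (ϖ ^ (d₀ + 1)) v.1}) =
      {M : Submodule 𝒪[K] (Fin 3 → K) | IsSelfDualLattice σ ϖ (!![((!![(0 : K), 1; 1, 0] : Matrix (Fin 2) (Fin 2) K)) 0 0, 0, ((!![(0 : K), 1; 1, 0] : Matrix (Fin 2) (Fin 2) K)) 0 1; 0, (1 : K), 0; ((!![(0 : K), 1; 1, 0] : Matrix (Fin 2) (Fin 2) K)) 1 0, 0, ((!![(0 : K), 1; 1, 0] : Matrix (Fin 2) (Fin 2) K)) 1 1] : Matrix (Fin 3) (Fin 3) K) M ∧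
        mapGL (endoGL (B₀, (1 : GL (Fin 1) K))) M = M ∧ (Pi.single 1 1 : Fin 3 → K) ∈ M ∧ (M.map ((Matrix.toLin' (((endoGL (B₀, (1 : GL (Fin 1) K)) : GL (Fin 3) K) : Matrix (Fin 3) (Fin 3) K) - 1)).restrictScalars 𝒪[K]) ≤ scaleLattice (ϖ ^ d₀) M ∧
          ∀ y ∈ M, y 1 = 0 → ((((endoGL (B₀, (1 : GL (Fin 1) K)) : GL (Fin 3) K) : Matrix (Fin 3) (Fin 3) K) - ((B₀ : Matrix (Fin 2) (Fin 2) K).trace / 2) • (1 : Matrix (Fin 3) (Fin 3) K)) *ᵥ y) ∈ scaleLattice (ϖ ^ (d₀ + 1)) M)} := by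
    ext M
    simp only [Set.mem_image, Set.mem_setOf_eq]
    constructor
    · rintro ⟨v, ⟨⟨hfix, hSD, hlev⟩, hkind⟩, rfl⟩
      have e := congrArg Subtype.val hfix
      rw [latticeGraphIso_apply_coe, hγ] at e
      have hSD' : IsSelfDualLattice σ ϖ (!![((!![(0 : K), 1; 1, 0] : Matrix (Fin 2) (Fin 2) K)) 0 0, 0, ((!![(0 : K), 1; 1, 0] : Matrix (Fin 2) (Fin 2) K)) 0 1; 0, (1 : K), 0; ((!![(0 : K), 1; 1, 0] : Matrix (Fin 2) (Fin 2) K)) 1 0, 0, ((!![(0 : K), 1; 1, 0] : Matrix (Fin 2) (Fin 2) K)) 1 1] : Matrix (Fin 3) (Fin 3) K) v.1 := by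
        rw [← antidiagonal_three_over_eq_endoShape]; exact hSD
      have hax := single_one_one_mem_of_mem_rootRegion_of_top hσ hvσ hϖ h2 γ B₀ (1 : GL (Fin 1) K) hγ hγU hα' htop v ⟨hfix, hSD, hlev⟩
      rw [hγ] at hlev hkind
      exact ⟨hSD', e, hax, hlev, hkind⟩
    · rintro ⟨hSD, hfix, -, hlev, hkind⟩
      rw [← antidiagonal_three_over_eq_endoShape] at hSD
      refine ⟨⟨M, 0, hSD⟩, ⟨⟨?_, hSD, ?_⟩, ?_⟩, rfl⟩
      · apply Subtype.ext
        rw [latticeGraphIso_apply_coe, hγ]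
        exact hfix
      · rw [hγ]; exact hlev
      · rw [hγ]; exact hkind
  rw [← Set.ncard_image_of_injective _ Subtype.val_injective, himg]
  refine ncard_selfDual_fixed_axis_eq σ hvσ hϖ0 hϖ1 hH₂ (h := (1 : K)) (by rw [map_one]) B₀ hu
    (fun M => M.map ((Matrix.toLin' (((endoGL (B₀, (1 : GL (Fin 1) K)) : GL (Fin 3) K) : Matrix (Fin 3) (Fin 3) K) - 1)).restrictScalars 𝒪[K]) ≤ scaleLattice (ϖ ^ d₀) M ∧
      ∀ y ∈ M, y 1 = 0 → ((((endoGL (B₀, (1 : GL (Fin 1) K)) : GL (Fin 3) K) : Matrix (Fin 3) (Fin 3) K) - ((B₀ : Matrix (Fin 2) (Fin 2) K).trace / 2) • (1 : Matrix (Fin 3) (Fin 3) K)) *ᵥ y) ∈ scaleLattice (ϖ ^ (d₀ + 1)) M)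
    (fun B => B.map ((Matrix.toLin' ((B₀ : Matrix (Fin 2) (Fin 2) K) - 1)).restrictScalars 𝒪[K]) ≤ scaleLattice (ϖ ^ d₀) B ∧
      B.map ((Matrix.toLin' ((B₀ : Matrix (Fin 2) (Fin 2) K) - ((B₀ : Matrix (Fin 2) (Fin 2) K).trace / 2) • (1 : Matrix (Fin 2) (Fin 2) K))).restrictScalars 𝒪[K]) ≤
        scaleLattice (ϖ ^ (d₀ + 1)) B) fun g₂ => ?_
  -- the label at an axis frame `latt ι(g₂, 1)`: both tokens move to the `W`-block
  rw [map_endoGL_sub_one_latt_endoGL_le_scaleLattice_iff (pow_ne_zero d₀ hϖ0),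
    forall_centred_mulVec_mem_scaleLattice_latt_endoGL_one_iff (pow_ne_zero (d₀ + 1) hϖ0)]
  exact ⟨fun H => ⟨H.1.1, H.2⟩, fun H => ⟨⟨H.1, hud⟩, H.2⟩⟩


set_option maxHeartbeats 1600000 in -- budget only: statement-heavy lattice tokens.
/-- **THE SHELL KIND OF THE ROOT REGION AT THE TOP LEVEL, CLASS PRESENT, ANY CONSTANT `t`, COUNTED ON THE `W`-SIDE** (regime A-even; F0P3a-p08 (g21)'s regime-B head
`ncard_rootRegion_shell_class_eq_ncard_two` with the top-emptiness premise and a free class constant `t` — in regime A-even `t₀ = (ϖ^{d₀})⁻¹·(½tr B₀ − 1)` is NOT a unit):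
`#{v ∣ v ∈ R ∧ ¬Pin v ∧ Qbig v} = #{B ∣ SD_{Φ₂} B ∧ B₀B = B ∧ ((B₀ − 1)B ≤ ϖ^{d₀}B ∧ ¬(B₀ − cB·1)B ≤ ϖ^{d₀+1}B ∧ CLS^{c,W}_{d₀}(t₀)(B))}` (the boundary shell of the
`W`-ball, centred class `t₀` present). [cite: Kottwitz1986, §3] [cite: BruhatTits1972, §10] [cite: LabesseLanglands1979, §2 Lemma 2.1 p. 8] [cite: Rogawski1990, §4.9 pp. 54–56] -/
theorem ncard_rootRegion_shell_class_eq_ncard_two_of_top [IsPrincipalIdealRing 𝒪[K]] {σ : K →+* K} {ϖ : K}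
    (hσ : ∀ a, σ (σ a) = a) (hvσ : ∀ a, Valued.v (σ a) = Valued.v a) (hϖ : Valued.v ϖ = WithZero.exp (-1 : ℤ))
    (γ : unitaryGroupOfForm σ ((StdForm.antidiagonal 3).over K)) (B₀ : GL (Fin 2) K) (hγ : (γ : GL (Fin 3) K) = endoGL (B₀, (1 : GL (Fin 1) K))) {d₀ : ℕ}
    (h2 : Valued.v (2 : K) = 1) (hγU : B₀ ∈ unitaryGroupOfForm σ (!![(0 : K), 1; 1, 0] : Matrix (Fin 2) (Fin 2) K))
    (hα : Valued.v ((B₀ : Matrix (Fin 2) (Fin 2) K).trace / 2 - 1) ≤ Valued.v (ϖ ^ (d₀ + 1)))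
    (htop : {B : Submodule 𝒪[K] (Fin 2 → K) | IsSelfDualLattice σ ϖ (!![(0 : K), 1; 1, 0] : Matrix (Fin 2) (Fin 2) K) B ∧ mapGL B₀ B = B ∧
        B.map ((Matrix.toLin' ((B₀ : Matrix (Fin 2) (Fin 2) K) - ((B₀ : Matrix (Fin 2) (Fin 2) K).trace / 2) • (1 : Matrix (Fin 2) (Fin 2) K))).restrictScalars 𝒪[K]) ≤
          scaleLattice (ϖ ^ (d₀ + 1)) B} = ∅) (t : K) :
    {v : {M : Submodule 𝒪[K] (Fin 3 → K) // IsVertex σ ϖ ((StdForm.antidiagonal 3).over K) M} | v ∈ {v : {M : Submodule 𝒪[K] (Fin 3 → K) // IsVertex σ ϖ ((StdForm.antidiagonal 3).over K) M} | latticeGraphIso σ ϖ ((StdForm.antidiagonal 3).over K) γ v = v ∧ IsSelfDualLattice σ ϖ ((StdForm.antidiagonal 3).over K) v.1 ∧ v.1.map ((Matrix.toLin' (((γ : GL (Fin 3) K) : Matrix (Fin 3) (Fin 3) K) - 1)).restrictScalars 𝒪[K]) ≤ scaleLattice (ϖ ^ d₀) v.1} ∧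
        ¬ (∀ y ∈ v.1, y 1 = 0 → ((((γ : GL (Fin 3) K) : Matrix (Fin 3) (Fin 3) K) - ((B₀ : Matrix (Fin 2) (Fin 2) K).trace / 2) • (1 : Matrix (Fin 3) (Fin 3) K)) *ᵥ y) ∈ scaleLattice (ϖ ^ (d₀ + 1)) v.1) ∧
        ∃ y ∈ v.1, y 1 = 0 ∧ ∃ a : K, Valued.v a = 1 ∧ Valued.v ((ϖ ^ d₀)⁻¹ * pairing σ ((StdForm.antidiagonal 3).over K) y ((((γ : GL (Fin 3) K) : Matrix (Fin 3) (Fin 3) K) - ((B₀ : Matrix (Fin 2) (Fin 2) K).trace / 2) • (1 : Matrix (Fin 3) (Fin 3) K)) *ᵥ y) - t * a ^ 2) < 1}.ncard =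
    {B : Submodule 𝒪[K] (Fin 2 → K) | IsSelfDualLattice σ ϖ (!![(0 : K), 1; 1, 0] : Matrix (Fin 2) (Fin 2) K) B ∧ mapGL B₀ B = B ∧
        (B.map ((Matrix.toLin' ((B₀ : Matrix (Fin 2) (Fin 2) K) - 1)).restrictScalars 𝒪[K]) ≤ scaleLattice (ϖ ^ d₀) B ∧
          ¬ B.map ((Matrix.toLin' ((B₀ : Matrix (Fin 2) (Fin 2) K) - ((B₀ : Matrix (Fin 2) (Fin 2) K).trace / 2) • (1 : Matrix (Fin 2) (Fin 2) K))).restrictScalars 𝒪[K]) ≤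
            scaleLattice (ϖ ^ (d₀ + 1)) B ∧
          ∃ y₂ ∈ B, ∃ a : K, Valued.v a = 1 ∧ Valued.v ((ϖ ^ d₀)⁻¹ * pairing σ (!![(0 : K), 1; 1, 0] : Matrix (Fin 2) (Fin 2) K) y₂ ((((B₀ : Matrix (Fin 2) (Fin 2) K)) - ((B₀ : Matrix (Fin 2) (Fin 2) K).trace / 2) • (1 : Matrix (Fin 2) (Fin 2) K)) *ᵥ y₂) - t * a ^ 2) < 1)}.ncard := by
  have hϖ0' : Valued.v ϖ ≠ 0 := by rw [hϖ]; exact WithZero.exp_ne_zero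
  have hϖ0 : ϖ ≠ 0 := fun h0 => by rw [h0, map_zero] at hϖ0'; exact hϖ0' rfl
  have hϖ1 : Valued.v ϖ ≤ 1 := by rw [hϖ, ← WithZero.exp_zero]; exact WithZero.exp_le_exp.2 (by norm_num)
  have hH₂ : IsUnit (!![(0 : K), 1; 1, 0] : Matrix (Fin 2) (Fin 2) K).det := by
    rw [Matrix.det_fin_two]; simp
  have hu : Valued.v (((1 : GL (Fin 1) K) : Matrix (Fin 1) (Fin 1) K) 0 0) = 1 := by rw [Units.val_one, Matrix.one_apply_eq, map_one]
  have hud : Valued.v (((1 : GL (Fin 1) K) : Matrix (Fin 1) (Fin 1) K) 0 0 - 1) ≤ Valued.v (ϖ ^ d₀) := by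
    rw [Units.val_one, Matrix.one_apply_eq, sub_self, map_zero]; exact zero_le
  have hα' : Valued.v ((B₀ : Matrix (Fin 2) (Fin 2) K).trace / 2 - ((1 : GL (Fin 1) K) : Matrix (Fin 1) (Fin 1) K) 0 0) ≤ Valued.v (ϖ ^ (d₀ + 1)) := by
    rw [Units.val_one, Matrix.one_apply_eq]; exact hα
  -- the vertex set is the copy of the rank-3 lattice set under `v ↦ v.1`, and every member is an axis vertex (★ p849253 THM 2)
  have himg : (Subtype.val '' {v : {M : Submodule 𝒪[K] (Fin 3 → K) // IsVertex σ ϖ ((StdForm.antidiagonal 3).over K) M} | v ∈ {v : {M : Submodule 𝒪[K] (Fin 3 → K) // IsVertex σ ϖ ((StdForm.antidiagonal 3).over K) M} | latticeGraphIso σ ϖ ((StdForm.antidiagonal 3).over K) γ v = v ∧ IsSelfDualLattice σ ϖ ((StdForm.antidiagonal 3).over K) v.1 ∧ v.1.map ((Matrix.toLin' (((γ : GL (Fin 3) K) : Matrix (Fin 3) (Fin 3) K) - 1)).restrictScalars 𝒪[K]) ≤ scaleLattice (ϖ ^ d₀) v.1} ∧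
        ¬ (∀ y ∈ v.1, y 1 = 0 → ((((γ : GL (Fin 3) K) : Matrix (Fin 3) (Fin 3) K) - ((B₀ : Matrix (Fin 2) (Fin 2) K).trace / 2) • (1 : Matrix (Fin 3) (Fin 3) K)) *ᵥ y) ∈ scaleLattice (ϖ ^ (d₀ + 1)) v.1) ∧
        ∃ y ∈ v.1, y 1 = 0 ∧ ∃ a : K, Valued.v a = 1 ∧ Valued.v ((ϖ ^ d₀)⁻¹ * pairing σ ((StdForm.antidiagonal 3).over K) y ((((γ : GL (Fin 3) K) : Matrix (Fin 3) (Fin 3) K) - ((B₀ : Matrix (Fin 2) (Fin 2) K).trace / 2) • (1 : Matrix (Fin 3) (Fin 3) K)) *ᵥ y) - t * a ^ 2) < 1}) =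
      {M : Submodule 𝒪[K] (Fin 3 → K) | IsSelfDualLattice σ ϖ (!![((!![(0 : K), 1; 1, 0] : Matrix (Fin 2) (Fin 2) K)) 0 0, 0, ((!![(0 : K), 1; 1, 0] : Matrix (Fin 2) (Fin 2) K)) 0 1; 0, (1 : K), 0; ((!![(0 : K), 1; 1, 0] : Matrix (Fin 2) (Fin 2) K)) 1 0, 0, ((!![(0 : K), 1; 1, 0] : Matrix (Fin 2) (Fin 2) K)) 1 1] : Matrix (Fin 3) (Fin 3) K) M ∧
        mapGL (endoGL (B₀, (1 : GL (Fin 1) K))) M = M ∧ (Pi.single 1 1 : Fin 3 → K) ∈ M ∧ (M.map ((Matrix.toLin' (((endoGL (B₀, (1 : GL (Fin 1) K)) : GL (Fin 3) K) : Matrix (Fin 3) (Fin 3) K) - 1)).restrictScalars 𝒪[K]) ≤ scaleLattice (ϖ ^ d₀) M ∧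
          ¬ (∀ y ∈ M, y 1 = 0 → ((((endoGL (B₀, (1 : GL (Fin 1) K)) : GL (Fin 3) K) : Matrix (Fin 3) (Fin 3) K) - ((B₀ : Matrix (Fin 2) (Fin 2) K).trace / 2) • (1 : Matrix (Fin 3) (Fin 3) K)) *ᵥ y) ∈ scaleLattice (ϖ ^ (d₀ + 1)) M) ∧
          ∃ y ∈ M, y 1 = 0 ∧ ∃ a : K, Valued.v a = 1 ∧ Valued.v ((ϖ ^ d₀)⁻¹ * pairing σ ((StdForm.antidiagonal 3).over K) y ((((endoGL (B₀, (1 : GL (Fin 1) K)) : GL (Fin 3) K) : Matrix (Fin 3) (Fin 3) K) - ((B₀ : Matrix (Fin 2) (Fin 2) K).trace / 2) • (1 : Matrix (Fin 3) (Fin 3) K)) *ᵥ y) - t * a ^ 2) < 1)} := by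
    ext M
    simp only [Set.mem_image, Set.mem_setOf_eq]
    constructor
    · rintro ⟨v, ⟨⟨hfix, hSD, hlev⟩, hkind⟩, rfl⟩
      have e := congrArg Subtype.val hfix
      rw [latticeGraphIso_apply_coe, hγ] at e
      have hSD' : IsSelfDualLattice σ ϖ (!![((!![(0 : K), 1; 1, 0] : Matrix (Fin 2) (Fin 2) K)) 0 0, 0, ((!![(0 : K), 1; 1, 0] : Matrix (Fin 2) (Fin 2) K)) 0 1; 0, (1 : K), 0; ((!![(0 : K), 1; 1, 0] : Matrix (Fin 2) (Fin 2) K)) 1 0, 0, ((!![(0 : K), 1; 1, 0] : Matrix (Fin 2) (Fin 2) K)) 1 1] : Matrix (Fin 3) (Fin 3) K) v.1 := by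
        rw [← antidiagonal_three_over_eq_endoShape]; exact hSD
      have hax := single_one_one_mem_of_mem_rootRegion_of_top hσ hvσ hϖ h2 γ B₀ (1 : GL (Fin 1) K) hγ hγU hα' htop v ⟨hfix, hSD, hlev⟩
      rw [hγ] at hlev hkind
      exact ⟨hSD', e, hax, hlev, hkind⟩
    · rintro ⟨hSD, hfix, -, hlev, hkind⟩
      rw [← antidiagonal_three_over_eq_endoShape] at hSD
      refine ⟨⟨M, 0, hSD⟩, ⟨⟨?_, hSD, ?_⟩, ?_⟩, rfl⟩
      · apply Subtype.ext
        rw [latticeGraphIso_apply_coe, hγ]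
        exact hfix
      · rw [hγ]; exact hlev
      · rw [hγ]; exact hkind
  rw [← Set.ncard_image_of_injective _ Subtype.val_injective, himg]
  refine ncard_selfDual_fixed_axis_eq σ hvσ hϖ0 hϖ1 hH₂ (h := (1 : K)) (by rw [map_one]) B₀ hu
    (fun M => M.map ((Matrix.toLin' (((endoGL (B₀, (1 : GL (Fin 1) K)) : GL (Fin 3) K) : Matrix (Fin 3) (Fin 3) K) - 1)).restrictScalars 𝒪[K]) ≤ scaleLattice (ϖ ^ d₀) M ∧
      ¬ (∀ y ∈ M, y 1 = 0 → ((((endoGL (B₀, (1 : GL (Fin 1) K)) : GL (Fin 3) K) : Matrix (Fin 3) (Fin 3) K) - ((B₀ : Matrix (Fin 2) (Fin 2) K).trace / 2) • (1 : Matrix (Fin 3) (Fin 3) K)) *ᵥ y) ∈ scaleLattice (ϖ ^ (d₀ + 1)) M) ∧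
      ∃ y ∈ M, y 1 = 0 ∧ ∃ a : K, Valued.v a = 1 ∧ Valued.v ((ϖ ^ d₀)⁻¹ * pairing σ ((StdForm.antidiagonal 3).over K) y ((((endoGL (B₀, (1 : GL (Fin 1) K)) : GL (Fin 3) K) : Matrix (Fin 3) (Fin 3) K) - ((B₀ : Matrix (Fin 2) (Fin 2) K).trace / 2) • (1 : Matrix (Fin 3) (Fin 3) K)) *ᵥ y) - t * a ^ 2) < 1)
    (fun B => B.map ((Matrix.toLin' ((B₀ : Matrix (Fin 2) (Fin 2) K) - 1)).restrictScalars 𝒪[K]) ≤ scaleLattice (ϖ ^ d₀) B ∧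
      ¬ B.map ((Matrix.toLin' ((B₀ : Matrix (Fin 2) (Fin 2) K) - ((B₀ : Matrix (Fin 2) (Fin 2) K).trace / 2) • (1 : Matrix (Fin 2) (Fin 2) K))).restrictScalars 𝒪[K]) ≤
        scaleLattice (ϖ ^ (d₀ + 1)) B ∧
      ∃ y₂ ∈ B, ∃ a : K, Valued.v a = 1 ∧ Valued.v ((ϖ ^ d₀)⁻¹ * pairing σ (!![(0 : K), 1; 1, 0] : Matrix (Fin 2) (Fin 2) K) y₂ ((((B₀ : Matrix (Fin 2) (Fin 2) K)) - ((B₀ : Matrix (Fin 2) (Fin 2) K).trace / 2) • (1 : Matrix (Fin 2) (Fin 2) K)) *ᵥ y₂) - t * a ^ 2) < 1) fun g₂ => ?_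
  -- the label at an axis frame `latt ι(g₂, 1)`: all three tokens move to the `W`-block
  simp only [antidiagonal_three_over_eq_endoShape]
  rw [map_endoGL_sub_one_latt_endoGL_le_scaleLattice_iff (pow_ne_zero d₀ hϖ0),
    forall_centred_mulVec_mem_scaleLattice_latt_endoGL_one_iff (pow_ne_zero (d₀ + 1) hϖ0),
    exists_centred_class_latt_endoGL_one_iff]
  exact ⟨fun H => ⟨H.1.1, H.2⟩, fun H => ⟨⟨H.1, hud⟩, H.2⟩⟩


set_option maxHeartbeats 1600000 in -- budget only: statement-heavy lattice tokens.
/-- **THE SHELL KIND OF THE ROOT REGION AT THE TOP LEVEL, CLASS ABSENT, ANY CONSTANT `t`** — the twin of `ncard_rootRegion_shell_class_eq_ncard_two_of_top` with `¬Qbig_t` ∕ `¬CLS^{c,W}(t)` on both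
sides (the three kinds partition the region; FILE 2 evaluates the `W`-side counts in regime B). [cite: Kottwitz1986, §3] [cite: BruhatTits1972, §10]
[cite: LabesseLanglands1979, §2 Lemma 2.1 p. 8] [cite: Rogawski1990, §4.9 pp. 54–56] -/
theorem ncard_rootRegion_shell_not_class_eq_ncard_two_of_top [IsPrincipalIdealRing 𝒪[K]] {σ : K →+* K} {ϖ : K}
    (hσ : ∀ a, σ (σ a) = a) (hvσ : ∀ a, Valued.v (σ a) = Valued.v a) (hϖ : Valued.v ϖ = WithZero.exp (-1 : ℤ))
    (γ : unitaryGroupOfForm σ ((StdForm.antidiagonal 3).over K)) (B₀ : GL (Fin 2) K) (hγ : (γ : GL (Fin 3) K) = endoGL (B₀, (1 : GL (Fin 1) K))) {d₀ : ℕ}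
    (h2 : Valued.v (2 : K) = 1) (hγU : B₀ ∈ unitaryGroupOfForm σ (!![(0 : K), 1; 1, 0] : Matrix (Fin 2) (Fin 2) K))
    (hα : Valued.v ((B₀ : Matrix (Fin 2) (Fin 2) K).trace / 2 - 1) ≤ Valued.v (ϖ ^ (d₀ + 1)))
    (htop : {B : Submodule 𝒪[K] (Fin 2 → K) | IsSelfDualLattice σ ϖ (!![(0 : K), 1; 1, 0] : Matrix (Fin 2) (Fin 2) K) B ∧ mapGL B₀ B = B ∧
        B.map ((Matrix.toLin' ((B₀ : Matrix (Fin 2) (Fin 2) K) - ((B₀ : Matrix (Fin 2) (Fin 2) K).trace / 2) • (1 : Matrix (Fin 2) (Fin 2) K))).restrictScalars 𝒪[K]) ≤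
          scaleLattice (ϖ ^ (d₀ + 1)) B} = ∅) (t : K) :
    {v : {M : Submodule 𝒪[K] (Fin 3 → K) // IsVertex σ ϖ ((StdForm.antidiagonal 3).over K) M} | v ∈ {v : {M : Submodule 𝒪[K] (Fin 3 → K) // IsVertex σ ϖ ((StdForm.antidiagonal 3).over K) M} | latticeGraphIso σ ϖ ((StdForm.antidiagonal 3).over K) γ v = v ∧ IsSelfDualLattice σ ϖ ((StdForm.antidiagonal 3).over K) v.1 ∧ v.1.map ((Matrix.toLin' (((γ : GL (Fin 3) K) : Matrix (Fin 3) (Fin 3) K) - 1)).restrictScalars 𝒪[K]) ≤ scaleLattice (ϖ ^ d₀) v.1} ∧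
        ¬ (∀ y ∈ v.1, y 1 = 0 → ((((γ : GL (Fin 3) K) : Matrix (Fin 3) (Fin 3) K) - ((B₀ : Matrix (Fin 2) (Fin 2) K).trace / 2) • (1 : Matrix (Fin 3) (Fin 3) K)) *ᵥ y) ∈ scaleLattice (ϖ ^ (d₀ + 1)) v.1) ∧
        ¬ (∃ y ∈ v.1, y 1 = 0 ∧ ∃ a : K, Valued.v a = 1 ∧ Valued.v ((ϖ ^ d₀)⁻¹ * pairing σ ((StdForm.antidiagonal 3).over K) y ((((γ : GL (Fin 3) K) : Matrix (Fin 3) (Fin 3) K) - ((B₀ : Matrix (Fin 2) (Fin 2) K).trace / 2) • (1 : Matrix (Fin 3) (Fin 3) K)) *ᵥ y) - t * a ^ 2) < 1)}.ncard =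
    {B : Submodule 𝒪[K] (Fin 2 → K) | IsSelfDualLattice σ ϖ (!![(0 : K), 1; 1, 0] : Matrix (Fin 2) (Fin 2) K) B ∧ mapGL B₀ B = B ∧
        (B.map ((Matrix.toLin' ((B₀ : Matrix (Fin 2) (Fin 2) K) - 1)).restrictScalars 𝒪[K]) ≤ scaleLattice (ϖ ^ d₀) B ∧
          ¬ B.map ((Matrix.toLin' ((B₀ : Matrix (Fin 2) (Fin 2) K) - ((B₀ : Matrix (Fin 2) (Fin 2) K).trace / 2) • (1 : Matrix (Fin 2) (Fin 2) K))).restrictScalars 𝒪[K]) ≤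
            scaleLattice (ϖ ^ (d₀ + 1)) B ∧
          ¬ (∃ y₂ ∈ B, ∃ a : K, Valued.v a = 1 ∧ Valued.v ((ϖ ^ d₀)⁻¹ * pairing σ (!![(0 : K), 1; 1, 0] : Matrix (Fin 2) (Fin 2) K) y₂ ((((B₀ : Matrix (Fin 2) (Fin 2) K)) - ((B₀ : Matrix (Fin 2) (Fin 2) K).trace / 2) • (1 : Matrix (Fin 2) (Fin 2) K)) *ᵥ y₂) - t * a ^ 2) < 1))}.ncard := by
  have hϖ0' : Valued.v ϖ ≠ 0 := by rw [hϖ]; exact WithZero.exp_ne_zero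
  have hϖ0 : ϖ ≠ 0 := fun h0 => by rw [h0, map_zero] at hϖ0'; exact hϖ0' rfl
  have hϖ1 : Valued.v ϖ ≤ 1 := by rw [hϖ, ← WithZero.exp_zero]; exact WithZero.exp_le_exp.2 (by norm_num)
  have hH₂ : IsUnit (!![(0 : K), 1; 1, 0] : Matrix (Fin 2) (Fin 2) K).det := by
    rw [Matrix.det_fin_two]; simp
  have hu : Valued.v (((1 : GL (Fin 1) K) : Matrix (Fin 1) (Fin 1) K) 0 0) = 1 := by rw [Units.val_one, Matrix.one_apply_eq, map_one]
  have hud : Valued.v (((1 : GL (Fin 1) K) : Matrix (Fin 1) (Fin 1) K) 0 0 - 1) ≤ Valued.v (ϖ ^ d₀) := by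
    rw [Units.val_one, Matrix.one_apply_eq, sub_self, map_zero]; exact zero_le
  have hα' : Valued.v ((B₀ : Matrix (Fin 2) (Fin 2) K).trace / 2 - ((1 : GL (Fin 1) K) : Matrix (Fin 1) (Fin 1) K) 0 0) ≤ Valued.v (ϖ ^ (d₀ + 1)) := by
    rw [Units.val_one, Matrix.one_apply_eq]; exact hα
  -- the vertex set is the copy of the rank-3 lattice set under `v ↦ v.1`, and every member is an axis vertex (★ p849253 THM 2)
  have himg : (Subtype.val '' {v : {M : Submodule 𝒪[K] (Fin 3 → K) // IsVertex σ ϖ ((StdForm.antidiagonal 3).over K) M} | v ∈ {v : {M : Submodule 𝒪[K] (Fin 3 → K) // IsVertex σ ϖ ((StdForm.antidiagonal 3).over K) M} | latticeGraphIso σ ϖ ((StdForm.antidiagonal 3).over K) γ v = v ∧ IsSelfDualLattice σ ϖ ((StdForm.antidiagonal 3).over K) v.1 ∧ v.1.map ((Matrix.toLin' (((γ : GL (Fin 3) K) : Matrix (Fin 3) (Fin 3) K) - 1)).restrictScalars 𝒪[K]) ≤ scaleLattice (ϖ ^ d₀) v.1} ∧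
        ¬ (∀ y ∈ v.1, y 1 = 0 → ((((γ : GL (Fin 3) K) : Matrix (Fin 3) (Fin 3) K) - ((B₀ : Matrix (Fin 2) (Fin 2) K).trace / 2) • (1 : Matrix (Fin 3) (Fin 3) K)) *ᵥ y) ∈ scaleLattice (ϖ ^ (d₀ + 1)) v.1) ∧
        ¬ (∃ y ∈ v.1, y 1 = 0 ∧ ∃ a : K, Valued.v a = 1 ∧ Valued.v ((ϖ ^ d₀)⁻¹ * pairing σ ((StdForm.antidiagonal 3).over K) y ((((γ : GL (Fin 3) K) : Matrix (Fin 3) (Fin 3) K) - ((B₀ : Matrix (Fin 2) (Fin 2) K).trace / 2) • (1 : Matrix (Fin 3) (Fin 3) K)) *ᵥ y) - t * a ^ 2) < 1)}) =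
      {M : Submodule 𝒪[K] (Fin 3 → K) | IsSelfDualLattice σ ϖ (!![((!![(0 : K), 1; 1, 0] : Matrix (Fin 2) (Fin 2) K)) 0 0, 0, ((!![(0 : K), 1; 1, 0] : Matrix (Fin 2) (Fin 2) K)) 0 1; 0, (1 : K), 0; ((!![(0 : K), 1; 1, 0] : Matrix (Fin 2) (Fin 2) K)) 1 0, 0, ((!![(0 : K), 1; 1, 0] : Matrix (Fin 2) (Fin 2) K)) 1 1] : Matrix (Fin 3) (Fin 3) K) M ∧
        mapGL (endoGL (B₀, (1 : GL (Fin 1) K))) M = M ∧ (Pi.single 1 1 : Fin 3 → K) ∈ M ∧ (M.map ((Matrix.toLin' (((endoGL (B₀, (1 : GL (Fin 1) K)) : GL (Fin 3) K) : Matrix (Fin 3) (Fin 3) K) - 1)).restrictScalars 𝒪[K]) ≤ scaleLattice (ϖ ^ d₀) M ∧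
          ¬ (∀ y ∈ M, y 1 = 0 → ((((endoGL (B₀, (1 : GL (Fin 1) K)) : GL (Fin 3) K) : Matrix (Fin 3) (Fin 3) K) - ((B₀ : Matrix (Fin 2) (Fin 2) K).trace / 2) • (1 : Matrix (Fin 3) (Fin 3) K)) *ᵥ y) ∈ scaleLattice (ϖ ^ (d₀ + 1)) M) ∧
          ¬ (∃ y ∈ M, y 1 = 0 ∧ ∃ a : K, Valued.v a = 1 ∧ Valued.v ((ϖ ^ d₀)⁻¹ * pairing σ ((StdForm.antidiagonal 3).over K) y ((((endoGL (B₀, (1 : GL (Fin 1) K)) : GL (Fin 3) K) : Matrix (Fin 3) (Fin 3) K) - ((B₀ : Matrix (Fin 2) (Fin 2) K).trace / 2) • (1 : Matrix (Fin 3) (Fin 3) K)) *ᵥ y) - t * a ^ 2) < 1))} := by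
    ext M
    simp only [Set.mem_image, Set.mem_setOf_eq]
    constructor
    · rintro ⟨v, ⟨⟨hfix, hSD, hlev⟩, hkind⟩, rfl⟩
      have e := congrArg Subtype.val hfix
      rw [latticeGraphIso_apply_coe, hγ] at e
      have hSD' : IsSelfDualLattice σ ϖ (!![((!![(0 : K), 1; 1, 0] : Matrix (Fin 2) (Fin 2) K)) 0 0, 0, ((!![(0 : K), 1; 1, 0] : Matrix (Fin 2) (Fin 2) K)) 0 1; 0, (1 : K), 0; ((!![(0 : K), 1; 1, 0] : Matrix (Fin 2) (Fin 2) K)) 1 0, 0, ((!![(0 : K), 1; 1, 0] : Matrix (Fin 2) (Fin 2) K)) 1 1] : Matrix (Fin 3) (Fin 3) K) v.1 := by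
        rw [← antidiagonal_three_over_eq_endoShape]; exact hSD
      have hax := single_one_one_mem_of_mem_rootRegion_of_top hσ hvσ hϖ h2 γ B₀ (1 : GL (Fin 1) K) hγ hγU hα' htop v ⟨hfix, hSD, hlev⟩
      rw [hγ] at hlev hkind
      exact ⟨hSD', e, hax, hlev, hkind⟩
    · rintro ⟨hSD, hfix, -, hlev, hkind⟩
      rw [← antidiagonal_three_over_eq_endoShape] at hSD
      refine ⟨⟨M, 0, hSD⟩, ⟨⟨?_, hSD, ?_⟩, ?_⟩, rfl⟩
      · apply Subtype.ext
        rw [latticeGraphIso_apply_coe, hγ]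
        exact hfix
      · rw [hγ]; exact hlev
      · rw [hγ]; exact hkind
  rw [← Set.ncard_image_of_injective _ Subtype.val_injective, himg]
  refine ncard_selfDual_fixed_axis_eq σ hvσ hϖ0 hϖ1 hH₂ (h := (1 : K)) (by rw [map_one]) B₀ hu
    (fun M => M.map ((Matrix.toLin' (((endoGL (B₀, (1 : GL (Fin 1) K)) : GL (Fin 3) K) : Matrix (Fin 3) (Fin 3) K) - 1)).restrictScalars 𝒪[K]) ≤ scaleLattice (ϖ ^ d₀) M ∧
      ¬ (∀ y ∈ M, y 1 = 0 → ((((endoGL (B₀, (1 : GL (Fin 1) K)) : GL (Fin 3) K) : Matrix (Fin 3) (Fin 3) K) - ((B₀ : Matrix (Fin 2) (Fin 2) K).trace / 2) • (1 : Matrix (Fin 3) (Fin 3) K)) *ᵥ y) ∈ scaleLattice (ϖ ^ (d₀ + 1)) M) ∧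
      ¬ (∃ y ∈ M, y 1 = 0 ∧ ∃ a : K, Valued.v a = 1 ∧ Valued.v ((ϖ ^ d₀)⁻¹ * pairing σ ((StdForm.antidiagonal 3).over K) y ((((endoGL (B₀, (1 : GL (Fin 1) K)) : GL (Fin 3) K) : Matrix (Fin 3) (Fin 3) K) - ((B₀ : Matrix (Fin 2) (Fin 2) K).trace / 2) • (1 : Matrix (Fin 3) (Fin 3) K)) *ᵥ y) - t * a ^ 2) < 1))
    (fun B => B.map ((Matrix.toLin' ((B₀ : Matrix (Fin 2) (Fin 2) K) - 1)).restrictScalars 𝒪[K]) ≤ scaleLattice (ϖ ^ d₀) B ∧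
      ¬ B.map ((Matrix.toLin' ((B₀ : Matrix (Fin 2) (Fin 2) K) - ((B₀ : Matrix (Fin 2) (Fin 2) K).trace / 2) • (1 : Matrix (Fin 2) (Fin 2) K))).restrictScalars 𝒪[K]) ≤
        scaleLattice (ϖ ^ (d₀ + 1)) B ∧
      ¬ (∃ y₂ ∈ B, ∃ a : K, Valued.v a = 1 ∧ Valued.v ((ϖ ^ d₀)⁻¹ * pairing σ (!![(0 : K), 1; 1, 0] : Matrix (Fin 2) (Fin 2) K) y₂ ((((B₀ : Matrix (Fin 2) (Fin 2) K)) - ((B₀ : Matrix (Fin 2) (Fin 2) K).trace / 2) • (1 : Matrix (Fin 2) (Fin 2) K)) *ᵥ y₂) - t * a ^ 2) < 1)) fun g₂ => ?_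
  -- the label at an axis frame `latt ι(g₂, 1)`: all three tokens move to the `W`-block
  simp only [antidiagonal_three_over_eq_endoShape]
  rw [map_endoGL_sub_one_latt_endoGL_le_scaleLattice_iff (pow_ne_zero d₀ hϖ0),
    forall_centred_mulVec_mem_scaleLattice_latt_endoGL_one_iff (pow_ne_zero (d₀ + 1) hϖ0),
    exists_centred_class_latt_endoGL_one_iff]
  exact ⟨fun H => ⟨H.1.1, H.2⟩, fun H => ⟨⟨H.1, hud⟩, H.2⟩⟩


end Literature.NumberTheory.Automorphic.UnitaryLatticeTree

end
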